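import Summits.QuantumFields.YangMills.Theorems.UnitScaleTiltProp7BlockDistanceWeights
import Summits.QuantumFields.YangMills.Theorems.UnitScaleTiltProp7MassiveDivergenceAgmonRow
import Literature.MathematicalPhysics.QuantumFieldTheory.Balaban1983to89.Beta.CombesThomasForm
import HarnessLib

/-!
# Route `UnitScaleTilt`, crux K1 «MinimiserStabilityRegPr» (stmt-QuantumFields-19200), EX row (5) ∕ STOREY H ∕ C6 letter `hUsup` — **(β-L²) LETTERS: THE CARRIER ROWS OF
# THE DUALITY ROAD TO THE DIVERGENCE-FORM AGMON `L²` ROW OF THE LOD RESOLVENT** (reweighted gradient with a growing exponential weight, the volume of the dual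
# block-distance weight, the real bookkeeping of the bootstrap) — consumed by `…Prop7LODDivergenceAgmonRow`

Cell `ym3-torus` (HUMAN RULING D-0037; rung R3 = SU(2) YM₃ on T³ — NOT d = 4, NOT infinite volume, NOT a mass gap, NOT Clay).  Width seat `ym3-torus-px21` (gen 17;
★p1 g28 CHAIR WORD №63 (2) ∕ №65 (4) «px21 g17 A-ROW-LOD: GO»; cst-p1 g38 18:01:57Z «GO (β-L²)»).  `--supports stmt-QuantumFields-19200 --as helper`; count-neutral;
THEOREMS ONLY (0 `def`, 0 `sorry`, 0 `instance`, default heartbeats).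

WHY.  C6's letter `hUsup` (`‖(G_a(D*_{U₀}x))(y)‖ ≤ Cu·X`, px13 g17 text 7916524ae76ffc76) is supplied, like STOREY H's `hWsup`, by a DOOR (local ½-Hölder `hHlocV` + an `L²` row
on `ℓ`-balls).  The `L²` row for the MASSLESS LOD operator `Δ^η_{U₀} + a·T(ι(Q″·))` is obtained in `…Prop7LODDivergenceAgmonRow` by DUALITY from px5 g11's site-source Agmon rows
✓`Prop7MassivePropagatorAgmon.agmon_rows_exp` at the GROWING weight `e^{+φ}`; this file holds the background-independent carrier rows that road needs:
the discrete Leibniz rule with the weight at the source, `D_V(ω·v)(y,μ) = ω(y)·(D_Vv)(y,μ) + η⁻¹(ω(y+e_μ) − ω(y))·Ad(V(y,μ))v(y+e_μ)`, whence for `ω = e^{ψ}` with per-bond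
slope `θ` the REWEIGHTED GRADIENT `Σ_b e^{2ψ(b₋)}‖(D_Vv)(b)‖² ≤ 2c₀⁻¹‖D_V(e^{ψ}v)‖² + 6r²c₀⁻¹‖e^{ψ}v‖²`, `r = ℓ(e^{θ} − 1) ≤ e·μ` at `θ = μη` (K-FREE because `D_V`
carries `η⁻¹ = ℓ` exactly once); the volume `Σ_x e^{−2φ_{B(y)}(x)} ≤ e^{6μ}(2(1 + 1∕(2μ)))³·ℓ³` of the dual weight (block by block, (W1)(iv) + (W2) of
✓`Prop7BlockDistanceWeights`); and the real bookkeeping `c₀S ≤ c₀XB`, `B² ≤ 3Sχ·(M·S)` ⟹ `S ≤ 3X²M·Sχ`.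

WHAT IS PROVED (ns `…Theorems.Prop7LODDivergenceAgmonLetters`; member `F n K`, weight `c₀ > 0`, ANY background `V`).  §1 `norm_sq_eq_c0_mul_sum`,
`equiv_smulSite`, ★`equiv_DL2_smulSite`, `toL2S_exp_smul_symm_eq` (FILE C's route-function weight `fun x => e^{φ x} • ·` read through `WL2.equiv`), `re_inner_le_of_bond_bound`,
`ell_mul_exp_sub_one_le`, ★★`sum_weightSq_normSq_DL2_le` (the reweighted gradient), `real_bootstrap`; §2 ★`sum_exp_neg_two_phi_le`.
HYP-SAT (★★OWNER RULING №42).  Identities and real inequalities about displayed terms; no `Prop` placeholder, no background smallness, no gauge letter, no room.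
HONEST SCOPE.  [folklore] lattice bookkeeping; the row itself is `…Prop7LODDivergenceAgmonRow`; `hUsup`, the DOOR, `hHlocV`, `hHωwRow`, EX, 19200 are NOT proved here;
nothing about d = 4, the continuum limit or a mass gap; the Yang–Mills mass gap is NOT proved.

References: T. Bałaban, CMP **99** (1985) 389–434 [Balaban1985BackgroundPropagators] ((3.3) p.391, (3.8) p.392, (3.11) p.392, (3.40) p.397, Thm 3.1 (3.46) p.398, (3.49) p.399);
CMP **96** (1984) 223–250 [Balaban1984PropagatorsII] (Lemma 2.1 p.234); S. Agmon, *Lectures on exponential decay of solutions of second-order elliptic equations* (1982)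
[Agmon1982] (Thm 1.5 p.19).
-/

set_option autoImplicit false

noncomputable section

open scoped BigOperators Matrix.Norms.L2Operator InnerProductSpace ComplexConjugate

namespace Summit.QuantumFields.YangMills.Theorems.Prop7LODDivergenceAgmonLetters

open Literature.MathematicalPhysics.QuantumFieldTheory.Balaban1983to89
open Literature.MathematicalPhysics.QuantumFieldTheory.Balaban1983to89.T3ContinuumYM3Torus
open Finset
open B5Eq118OneStroke (iterBlockOf iterBlock mem_iterBlock card_iterBlock)
open B4Sect5Torus (TSite tdist)
open B9SectCLatticeCarrier (Bond shift)
open B9Eq311L2Pairing (WL2)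
open B11Eq103H1Complex (SiteL2K BondL2K)
open T3SectALandauChart (eta eta_pos)
open Summit.QuantumFields.YangMills.Theorems.Prop7SectET3Transport (periodsT3 siteEquiv)
open Summit.QuantumFields.YangMills.Theorems.Prop7SectET3HilbertLetters (W₂ frobEquiv adBg toL2S toL2S_apply toL2S_symm_apply DL2)
open Summit.QuantumFields.YangMills.Theorems.Prop7KatoBootstrapMember (norm_adBg_eq)
open Summit.QuantumFields.YangMills.Theorems.Prop7TwoBackgroundGradientComparison (equiv_DL2_apply norm_inv_eta)
open Summit.QuantumFields.YangMills.Theorems.Prop7MassiveDivergenceAgmonRow (re_inner_eq_sum)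
open Summit.QuantumFields.YangMills.Theorems.Prop7BlockDistanceWeights (sum_exp_neg_mul_tdist_coarse_le eta_mul_pow_eq_one)
open Literature.MathematicalPhysics.QuantumFieldTheory.Balaban1983to89.Beta.CombesThomasForm (abs_exp_sub_one_le)

/-! ## §1 Carrier letters at the member (any background) -/

section Carrier

variable (F : T3Family) (n K : ℕ) (c₀ : ℝ) [Fact (0 < c₀)]

/-- `‖f‖² = c₀ · Σ_x ‖f(x)‖²` on the uniformly weighted `L²` carriers. [cite: Balaban1985BackgroundPropagators, (3.11) p.392] -/
theorem norm_sq_eq_c0_mul_sum {X : Type*} [Fintype X] (f : WL2 ℂ (fun _ : X => c₀) W₂) :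
    ‖f‖ ^ 2 = c₀ * ∑ x, ‖WL2.equiv ℂ (fun _ : X => c₀) W₂ f x‖ ^ 2 := by
  rw [WL2.norm_sq, ← Finset.mul_sum]

omit [Fact (0 < c₀)] in
/-- THE SITE MULTIPLIER read pointwise: `(ω·v)(y) = ω(y)·v(y)`. [cite: Balaban1985BackgroundPropagators, (3.40) p.397] -/
theorem equiv_smulSite (ω : TSite 3 (periodsT3 F K) → ℝ) (v : SiteL2K ℂ 3 (periodsT3 F K) c₀ W₂) (y : TSite 3 (periodsT3 F K)) :
    WL2.equiv ℂ (fun _ : TSite 3 (periodsT3 F K) => c₀) W₂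
        ((WL2.equiv ℂ (fun _ : TSite 3 (periodsT3 F K) => c₀) W₂).symm
          fun z => ((ω z : ℝ) : ℂ) • WL2.equiv ℂ (fun _ : TSite 3 (periodsT3 F K) => c₀) W₂ v z) y
      = ((ω y : ℝ) : ℂ) • WL2.equiv ℂ (fun _ : TSite 3 (periodsT3 F K) => c₀) W₂ v y := by
  rw [Equiv.apply_symm_apply]

/-- ★ THE DISCRETE LEIBNIZ RULE with the weight at the SOURCE and the defect on the transported TARGET value:
`D_V(ω·v)(y,μ) = ω(y)·(D_Vv)(y,μ) + η⁻¹(ω(y+e_μ) − ω(y))·Ad(V(y,μ))v(y+e_μ)`. [cite: Balaban1985BackgroundPropagators, (3.3) p.391] -/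
theorem equiv_DL2_smulSite (V : GaugeField (F.P K) 0 (Matrix.specialUnitaryGroup (Fin 2) ℂ)) (ω : TSite 3 (periodsT3 F K) → ℝ)
    (v : SiteL2K ℂ 3 (periodsT3 F K) c₀ W₂) (y : TSite 3 (periodsT3 F K)) (μ : Fin 3) :
    WL2.equiv ℂ (fun _ : Bond 3 (periodsT3 F K) => c₀) W₂
        (DL2 F n K c₀ V ((WL2.equiv ℂ (fun _ : TSite 3 (periodsT3 F K) => c₀) W₂).symm
          fun z => ((ω z : ℝ) : ℂ) • WL2.equiv ℂ (fun _ : TSite 3 (periodsT3 F K) => c₀) W₂ v z)) (y, μ)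
      = ((ω y : ℝ) : ℂ) • WL2.equiv ℂ (fun _ : Bond 3 (periodsT3 F K) => c₀) W₂ (DL2 F n K c₀ V v) (y, μ)
        + ((((eta F n K : ℝ) : ℂ))⁻¹ * (((ω (shift μ y) : ℝ) : ℂ) - ((ω y : ℝ) : ℂ))) •
          adBg F K V (y, μ) (WL2.equiv ℂ (fun _ : TSite 3 (periodsT3 F K) => c₀) W₂ v (shift μ y)) := by
  rw [equiv_DL2_apply, equiv_DL2_apply, equiv_smulSite, equiv_smulSite, map_smul]
  module

omit [Fact (0 < c₀)] in
/-- FILE C's route-function weight read through `WL2.equiv`: `toL2S(e^{φ}·toL2S⁻¹v) = (e^{φ∘e⁻¹})·v`. [cite: Balaban1985BackgroundPropagators, p.393] -/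
theorem toL2S_exp_smul_symm_eq (φ : Site (F.P K) 0 → ℝ) (v : SiteL2K ℂ 3 (periodsT3 F K) c₀ W₂) :
    toL2S F K c₀ (fun x => Real.exp (φ x) • (toL2S F K c₀).symm v x)
      = (WL2.equiv ℂ (fun _ : TSite 3 (periodsT3 F K) => c₀) W₂).symm
          fun y => ((Real.exp (φ ((siteEquiv F K).symm y)) : ℝ) : ℂ) • WL2.equiv ℂ (fun _ : TSite 3 (periodsT3 F K) => c₀) W₂ v y := by
  refine (WL2.equiv ℂ (fun _ : TSite 3 (periodsT3 F K) => c₀) W₂).injective (funext fun y => ?_)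
  rw [toL2S_apply, Equiv.apply_symm_apply]
  show frobEquiv.symm (Real.exp (φ ((siteEquiv F K).symm y)) • (toL2S F K c₀).symm v ((siteEquiv F K).symm y)) = _
  rw [toL2S_symm_apply, ← Complex.coe_smul, LinearEquiv.map_smul, LinearEquiv.symm_apply_apply, Equiv.apply_symm_apply]

/-- `re ⟪f, x⟫ ≤ c₀ · X · Σ_b ‖f(b)‖` when `‖x(b)‖ ≤ X` on every bond. [cite: Balaban1985BackgroundPropagators, (3.11) p.392] -/
theorem re_inner_le_of_bond_bound (f x : BondL2K ℂ 3 (periodsT3 F K) c₀ W₂) {X : ℝ}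
    (hx : ∀ b, ‖WL2.equiv ℂ (fun _ : Bond 3 (periodsT3 F K) => c₀) W₂ x b‖ ≤ X) :
    (⟪f, x⟫_ℂ).re ≤ c₀ * X * ∑ b, ‖WL2.equiv ℂ (fun _ : Bond 3 (periodsT3 F K) => c₀) W₂ f b‖ := by
  have hc₀ : 0 < c₀ := Fact.out
  rw [re_inner_eq_sum c₀, Finset.mul_sum]
  refine Finset.sum_le_sum fun b _ => ?_
  have h1 : (⟪WL2.equiv ℂ (fun _ : Bond 3 (periodsT3 F K) => c₀) W₂ f b, WL2.equiv ℂ (fun _ : Bond 3 (periodsT3 F K) => c₀) W₂ x b⟫_ℂ).re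
      ≤ ‖WL2.equiv ℂ (fun _ : Bond 3 (periodsT3 F K) => c₀) W₂ f b‖ * X :=
    (Complex.re_le_norm _).trans ((norm_inner_le_norm _ _).trans (mul_le_mul_of_nonneg_left (hx b) (norm_nonneg _)))
  nlinarith

/-- THE K-FREE DEFECT RATE: `ℓ·(e^{μη} − 1) ≤ e·μ` for `0 ≤ μ ≤ 1` (`ηℓ = 1`, `ℓ ≥ 1`). [cite: Balaban1985BackgroundPropagators, Thm 3.1 (3.46) p.398] -/
theorem ell_mul_exp_sub_one_le {μ : ℝ} (hμ : 0 ≤ μ) (hμ1 : μ ≤ 1) :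
    (F.L : ℝ) ^ (K - n) * (Real.exp (μ * eta F n K) - 1) ≤ Real.exp 1 * μ := by
  have hℓ1 : (1 : ℝ) ≤ (F.L : ℝ) ^ (K - n) := one_le_pow₀ (by exact_mod_cast F.hL.2.le)
  have hη : 0 < eta F n K := eta_pos F n K
  have hηℓ : eta F n K * (F.L : ℝ) ^ (K - n) = 1 := eta_mul_pow_eq_one F
  have hη1 : eta F n K ≤ 1 := by
    have : eta F n K * 1 ≤ eta F n K * (F.L : ℝ) ^ (K - n) := mul_le_mul_of_nonneg_left hℓ1 hη.le
    linarith
  have hs : 0 ≤ μ * eta F n K := mul_nonneg hμ hη.le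
  have hs1 : μ * eta F n K ≤ 1 := by nlinarith
  -- `e^{s} − 1 ≤ s·e^{s}` (lit ✓`AreaLaw.exp_sub_one_le_mul_exp`, re-derived in three lines to keep the imports local)
  have h1 : Real.exp (μ * eta F n K) - 1 ≤ μ * eta F n K * Real.exp (μ * eta F n K) := by
    have e1 : 1 - μ * eta F n K ≤ Real.exp (-(μ * eta F n K)) := by have := Real.add_one_le_exp (-(μ * eta F n K)); linarith
    have e2 := mul_le_mul_of_nonneg_left e1 (Real.exp_pos (μ * eta F n K)).le
    rw [← Real.exp_add, add_neg_cancel, Real.exp_zero] at e2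
    nlinarith [Real.exp_pos (μ * eta F n K)]
  have h2 : Real.exp (μ * eta F n K) ≤ Real.exp 1 := Real.exp_le_exp.2 hs1
  calc (F.L : ℝ) ^ (K - n) * (Real.exp (μ * eta F n K) - 1) ≤ (F.L : ℝ) ^ (K - n) * (μ * eta F n K * Real.exp (μ * eta F n K)) :=
        mul_le_mul_of_nonneg_left h1 (by linarith)
    _ = (eta F n K * (F.L : ℝ) ^ (K - n)) * μ * Real.exp (μ * eta F n K) := by ring
    _ = μ * Real.exp (μ * eta F n K) := by rw [hηℓ, one_mul]
    _ ≤ μ * Real.exp 1 := mul_le_mul_of_nonneg_left h2 hμ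
    _ = Real.exp 1 * μ := mul_comm _ _

/-- ★ **THE REWEIGHTED GRADIENT**: for a positive site weight `ω = e^{ψ}` with per-bond slope `|ψ(y+e_μ) − ψ(y)| ≤ θ`, every background `V` and every `v`,
`Σ_b ω(b₋)²‖(D_Vv)(b)‖² ≤ 2c₀⁻¹‖D_V(ω·v)‖² + 6r²c₀⁻¹‖ω·v‖²` with `r = ℓ(e^{θ} − 1)` (`Ad` isometric, `‖η⁻¹‖ = ℓ`, each site is the target of three bonds).
[cite: Balaban1985BackgroundPropagators, (3.3) p.391, Thm 3.1 (3.46) p.398] -/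
theorem sum_weightSq_normSq_DL2_le (V : GaugeField (F.P K) 0 (Matrix.specialUnitaryGroup (Fin 2) ℂ)) (ψ : TSite 3 (periodsT3 F K) → ℝ) {θ : ℝ}
    (hψ : ∀ (y : TSite 3 (periodsT3 F K)) (μ : Fin 3), |ψ (shift μ y) - ψ y| ≤ θ) (v : SiteL2K ℂ 3 (periodsT3 F K) c₀ W₂) :
    ∑ b : Bond 3 (periodsT3 F K), Real.exp (ψ b.1) ^ 2 * ‖WL2.equiv ℂ (fun _ : Bond 3 (periodsT3 F K) => c₀) W₂ (DL2 F n K c₀ V v) b‖ ^ 2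
      ≤ 2 * c₀⁻¹ * ‖DL2 F n K c₀ V ((WL2.equiv ℂ (fun _ : TSite 3 (periodsT3 F K) => c₀) W₂).symm
            fun z => ((Real.exp (ψ z) : ℝ) : ℂ) • WL2.equiv ℂ (fun _ : TSite 3 (periodsT3 F K) => c₀) W₂ v z)‖ ^ 2
        + 6 * ((F.L : ℝ) ^ (K - n) * (Real.exp θ - 1)) ^ 2 * c₀⁻¹ *
          ‖(WL2.equiv ℂ (fun _ : TSite 3 (periodsT3 F K) => c₀) W₂).symm
            fun z => ((Real.exp (ψ z) : ℝ) : ℂ) • WL2.equiv ℂ (fun _ : TSite 3 (periodsT3 F K) => c₀) W₂ v z‖ ^ 2 := by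
  have hc₀ : 0 < c₀ := Fact.out
  set ℓ : ℝ := (F.L : ℝ) ^ (K - n) with hℓ
  set r : ℝ := ℓ * (Real.exp θ - 1) with hr
  set Ωv : SiteL2K ℂ 3 (periodsT3 F K) c₀ W₂ := (WL2.equiv ℂ (fun _ : TSite 3 (periodsT3 F K) => c₀) W₂).symm
      fun z => ((Real.exp (ψ z) : ℝ) : ℂ) • WL2.equiv ℂ (fun _ : TSite 3 (periodsT3 F K) => c₀) W₂ v z with hΩv
  have hθ0 : 0 ≤ θ := (abs_nonneg _).trans (hψ (fun _ => 0) 0)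
  have hr0 : 0 ≤ r := mul_nonneg (pow_nonneg (Nat.cast_nonneg _) _) (by linarith [Real.one_le_exp hθ0])
  -- the pointwise values of `Ωv`
  have hΩpt : ∀ z, ‖WL2.equiv ℂ (fun _ : TSite 3 (periodsT3 F K) => c₀) W₂ Ωv z‖ = Real.exp (ψ z) * ‖WL2.equiv ℂ (fun _ : TSite 3 (periodsT3 F K) => c₀) W₂ v z‖ := by
    intro z
    rw [hΩv, equiv_smulSite, norm_smul, Complex.norm_real, Real.norm_of_nonneg (Real.exp_pos _).le]
  -- bond by bond
  have hbond : ∀ (y : TSite 3 (periodsT3 F K)) (μ : Fin 3),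
      Real.exp (ψ y) ^ 2 * ‖WL2.equiv ℂ (fun _ : Bond 3 (periodsT3 F K) => c₀) W₂ (DL2 F n K c₀ V v) (y, μ)‖ ^ 2
        ≤ 2 * ‖WL2.equiv ℂ (fun _ : Bond 3 (periodsT3 F K) => c₀) W₂ (DL2 F n K c₀ V Ωv) (y, μ)‖ ^ 2
          + 2 * r ^ 2 * ‖WL2.equiv ℂ (fun _ : TSite 3 (periodsT3 F K) => c₀) W₂ Ωv (shift μ y)‖ ^ 2 := by
    intro y μ
    have hL := equiv_DL2_smulSite F n K c₀ V (fun z => Real.exp (ψ z)) v y μ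
    rw [← hΩv] at hL
    -- `ω(y)·Dv(b) = D(Ωv)(b) − defect`
    have hkey : ((Real.exp (ψ y) : ℝ) : ℂ) • WL2.equiv ℂ (fun _ : Bond 3 (periodsT3 F K) => c₀) W₂ (DL2 F n K c₀ V v) (y, μ)
        = WL2.equiv ℂ (fun _ : Bond 3 (periodsT3 F K) => c₀) W₂ (DL2 F n K c₀ V Ωv) (y, μ)
          - ((((eta F n K : ℝ) : ℂ))⁻¹ * (((Real.exp (ψ (shift μ y)) : ℝ) : ℂ) - ((Real.exp (ψ y) : ℝ) : ℂ))) •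
            adBg F K V (y, μ) (WL2.equiv ℂ (fun _ : TSite 3 (periodsT3 F K) => c₀) W₂ v (shift μ y)) := by
      rw [hL]; abel
    have hdef : ‖((((eta F n K : ℝ) : ℂ))⁻¹ * (((Real.exp (ψ (shift μ y)) : ℝ) : ℂ) - ((Real.exp (ψ y) : ℝ) : ℂ))) •
            adBg F K V (y, μ) (WL2.equiv ℂ (fun _ : TSite 3 (periodsT3 F K) => c₀) W₂ v (shift μ y))‖
        ≤ r * ‖WL2.equiv ℂ (fun _ : TSite 3 (periodsT3 F K) => c₀) W₂ Ωv (shift μ y)‖ := by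
      rw [norm_smul, norm_mul, norm_inv_eta, norm_adBg_eq, ← Complex.ofReal_sub, Complex.norm_real, Real.norm_eq_abs, hΩpt]
      -- `|e^{ψ₊} − e^{ψ}| = e^{ψ₊}·|1 − e^{ψ − ψ₊}| ≤ e^{ψ₊}·(e^{θ} − 1)`
      have hfac : Real.exp (ψ (shift μ y)) - Real.exp (ψ y) = Real.exp (ψ (shift μ y)) * (1 - Real.exp (ψ y - ψ (shift μ y))) := by
        rw [mul_sub, mul_one, ← Real.exp_add]; congr 1; ring_nf
      have h1 : |1 - Real.exp (ψ y - ψ (shift μ y))| ≤ Real.exp θ - 1 := by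
        rw [abs_sub_comm]; exact abs_exp_sub_one_le (by rw [abs_sub_comm]; exact hψ y μ)
      rw [hfac, abs_mul, abs_of_pos (Real.exp_pos _)]
      have hE := (Real.exp_pos (ψ (shift μ y))).le
      have hN := norm_nonneg (WL2.equiv ℂ (fun _ : TSite 3 (periodsT3 F K) => c₀) W₂ v (shift μ y))
      calc ℓ * (Real.exp (ψ (shift μ y)) * |1 - Real.exp (ψ y - ψ (shift μ y))|) * ‖WL2.equiv ℂ (fun _ : TSite 3 (periodsT3 F K) => c₀) W₂ v (shift μ y)‖
          ≤ ℓ * (Real.exp (ψ (shift μ y)) * (Real.exp θ - 1)) * ‖WL2.equiv ℂ (fun _ : TSite 3 (periodsT3 F K) => c₀) W₂ v (shift μ y)‖ := by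
            gcongr
        _ = r * (Real.exp (ψ (shift μ y)) * ‖WL2.equiv ℂ (fun _ : TSite 3 (periodsT3 F K) => c₀) W₂ v (shift μ y)‖) := by rw [hr]; ring
    have hsm : ‖((Real.exp (ψ y) : ℝ) : ℂ) • WL2.equiv ℂ (fun _ : Bond 3 (periodsT3 F K) => c₀) W₂ (DL2 F n K c₀ V v) (y, μ)‖
        = Real.exp (ψ y) * ‖WL2.equiv ℂ (fun _ : Bond 3 (periodsT3 F K) => c₀) W₂ (DL2 F n K c₀ V v) (y, μ)‖ := by
      rw [norm_smul, Complex.norm_real, Real.norm_of_nonneg (Real.exp_pos _).le]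
    have htri : Real.exp (ψ y) * ‖WL2.equiv ℂ (fun _ : Bond 3 (periodsT3 F K) => c₀) W₂ (DL2 F n K c₀ V v) (y, μ)‖
        ≤ ‖WL2.equiv ℂ (fun _ : Bond 3 (periodsT3 F K) => c₀) W₂ (DL2 F n K c₀ V Ωv) (y, μ)‖
          + r * ‖WL2.equiv ℂ (fun _ : TSite 3 (periodsT3 F K) => c₀) W₂ Ωv (shift μ y)‖ := by
      rw [← hsm, hkey]
      exact (norm_sub_le _ _).trans (add_le_add le_rfl hdef)
    have hA := norm_nonneg (WL2.equiv ℂ (fun _ : Bond 3 (periodsT3 F K) => c₀) W₂ (DL2 F n K c₀ V Ωv) (y, μ))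
    have hB := norm_nonneg (WL2.equiv ℂ (fun _ : TSite 3 (periodsT3 F K) => c₀) W₂ Ωv (shift μ y))
    have hC : 0 ≤ Real.exp (ψ y) * ‖WL2.equiv ℂ (fun _ : Bond 3 (periodsT3 F K) => c₀) W₂ (DL2 F n K c₀ V v) (y, μ)‖ :=
      mul_nonneg (Real.exp_pos _).le (norm_nonneg _)
    have hsq := pow_le_pow_left₀ hC htri 2
    rw [mul_pow] at hsq
    nlinarith [sq_nonneg (‖WL2.equiv ℂ (fun _ : Bond 3 (periodsT3 F K) => c₀) W₂ (DL2 F n K c₀ V Ωv) (y, μ)‖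
      - r * ‖WL2.equiv ℂ (fun _ : TSite 3 (periodsT3 F K) => c₀) W₂ Ωv (shift μ y)‖), hsq, mul_nonneg hr0 hB]
  -- sum over bonds
  have hsum := Finset.sum_le_sum fun b (_ : b ∈ (Finset.univ : Finset (Bond 3 (periodsT3 F K)))) => hbond b.1 b.2
  rw [Finset.sum_add_distrib, ← Finset.mul_sum, ← Finset.mul_sum] at hsum
  have hD : ∑ b : Bond 3 (periodsT3 F K), ‖WL2.equiv ℂ (fun _ : Bond 3 (periodsT3 F K) => c₀) W₂ (DL2 F n K c₀ V Ωv) (b.1, b.2)‖ ^ 2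
      = c₀⁻¹ * ‖DL2 F n K c₀ V Ωv‖ ^ 2 := by
    rw [norm_sq_eq_c0_mul_sum c₀, ← mul_assoc, inv_mul_cancel₀ hc₀.ne', one_mul]
  have hS : ∑ b : Bond 3 (periodsT3 F K), ‖WL2.equiv ℂ (fun _ : TSite 3 (periodsT3 F K) => c₀) W₂ Ωv (shift b.2 b.1)‖ ^ 2
      = 3 * (c₀⁻¹ * ‖Ωv‖ ^ 2) := by
    rw [norm_sq_eq_c0_mul_sum c₀, inv_mul_cancel_left₀ hc₀.ne', Fintype.sum_prod_type, Finset.sum_comm]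
    have hμ : ∀ μ : Fin 3, ∑ y : TSite 3 (periodsT3 F K), ‖WL2.equiv ℂ (fun _ : TSite 3 (periodsT3 F K) => c₀) W₂ Ωv (shift μ y)‖ ^ 2
        = ∑ y, ‖WL2.equiv ℂ (fun _ : TSite 3 (periodsT3 F K) => c₀) W₂ Ωv y‖ ^ 2 := fun μ =>
      Equiv.sum_comp (B9Eq33CovDerivVector.shiftEquiv μ) (fun y => ‖WL2.equiv ℂ (fun _ : TSite 3 (periodsT3 F K) => c₀) W₂ Ωv y‖ ^ 2)
    simp only [hμ, Finset.sum_const, Finset.card_univ, Fintype.card_fin, nsmul_eq_mul, Nat.cast_ofNat]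
  rw [hD, hS] at hsum
  calc ∑ b : Bond 3 (periodsT3 F K), Real.exp (ψ b.1) ^ 2 * ‖WL2.equiv ℂ (fun _ : Bond 3 (periodsT3 F K) => c₀) W₂ (DL2 F n K c₀ V v) b‖ ^ 2
      = ∑ b : Bond 3 (periodsT3 F K), Real.exp (ψ b.1) ^ 2 * ‖WL2.equiv ℂ (fun _ : Bond 3 (periodsT3 F K) => c₀) W₂ (DL2 F n K c₀ V v) (b.1, b.2)‖ ^ 2 := rfl
    _ ≤ _ := hsum
    _ = _ := by ring

/-- PURE REAL BOOKKEEPING of the duality bootstrap: `cS ≤ cXB`, `B² ≤ 3Sχ·(M·S)` ⟹ `S ≤ 3X²M·Sχ` (`c > 0`, `S, Sχ, M ≥ 0`). [folklore] -/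
theorem real_bootstrap {c S X B Sχ M : ℝ} (hc : 0 < c) (hS0 : 0 ≤ S) (hSχ : 0 ≤ Sχ) (hM : 0 ≤ M)
    (h2 : c * S ≤ c * X * B) (h3 : B ^ 2 ≤ 3 * Sχ * (M * S)) : S ≤ 3 * X ^ 2 * M * Sχ := by
  have hSXB : S ≤ X * B := le_of_mul_le_mul_left (by linarith [h2] : c * S ≤ c * (X * B)) hc
  have hsq : S * S ≤ (3 * X ^ 2 * M * Sχ) * S := by
    calc S * S ≤ (X * B) * (X * B) := mul_le_mul hSXB hSXB hS0 (hS0.trans hSXB)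
      _ = X ^ 2 * B ^ 2 := by ring
      _ ≤ X ^ 2 * (3 * Sχ * (M * S)) := mul_le_mul_of_nonneg_left h3 (sq_nonneg X)
      _ = (3 * X ^ 2 * M * Sχ) * S := by ring
  rcases eq_or_lt_of_le hS0 with hS | hS
  · rw [← hS]
    exact mul_nonneg (mul_nonneg (mul_nonneg (by norm_num) (sq_nonneg X)) hM) hSχ
  · exact le_of_mul_le_mul_right hsq hS

end Carrier

/-! ## §2 The volume of the block-distance weight -/

section Volume

variable (F : T3Family) {n K : ℕ} (h : n ≤ K)

/-- THE RADIAL SUM OF THE DUAL WEIGHT: for the block-distance weight `φ = φ_{B(y)}` of ✓`exists_blockDistanceWeight` (lower bound (iv): `μ(tdist(z,y) − 3) ≤ φ` on `B(z)`),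
`Σ_x e^{−2φ(x)} ≤ e^{6μ}·(2(1 + 1∕(2μ)))³·ℓ³` — block by block with the coarse exponential volume (W2). [cite: Balaban1985BackgroundPropagators, (3.49) p.399] -/
theorem sum_exp_neg_two_phi_le (y : Site (F.P K) (K - n)) {μ : ℝ} (hμ : 0 < μ) (φ : Site (F.P K) 0 → ℝ)
    (hlow : ∀ (z : Site (F.P K) (K - n)) (x : Site (F.P K) 0), iterBlockOf (K - n) x = z → μ * ((Site.tdist z y : ℝ) - 3) ≤ φ x) :
    ∑ x : Site (F.P K) 0, Real.exp (-(2 * φ x)) ≤ Real.exp (6 * μ) * (2 * (1 + 1 / (2 * μ))) ^ 3 * ((F.L : ℝ) ^ (K - n)) ^ 3 := by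
  have hk : K - n ≤ (F.P K).m + (F.P K).K := by show K - n ≤ F.m + K; omega
  have hcard : ∀ z : Site (F.P K) (K - n), ((iterBlock (K - n) z).card : ℝ) = ((F.L : ℝ) ^ (K - n)) ^ 3 := by
    intro z
    rw [card_iterBlock (K - n) hk z]
    push_cast
    show ((F.L : ℝ) ^ 3) ^ (K - n) = ((F.L : ℝ) ^ (K - n)) ^ 3
    rw [← pow_mul, ← pow_mul, mul_comm]
  rw [← Finset.sum_fiberwise Finset.univ (fun x => iterBlockOf (K - n) x) (fun x => Real.exp (-(2 * φ x)))]
  have hblock : ∀ z : Site (F.P K) (K - n),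
      ∑ x ∈ Finset.univ.filter (fun x => iterBlockOf (K - n) x = z), Real.exp (-(2 * φ x))
        ≤ ((F.L : ℝ) ^ (K - n)) ^ 3 * (Real.exp (6 * μ) * Real.exp (-(2 * μ * (Site.tdist z y : ℝ)))) := by
    intro z
    have hle : ∀ x ∈ Finset.univ.filter (fun x => iterBlockOf (K - n) x = z), Real.exp (-(2 * φ x)) ≤ Real.exp (6 * μ) * Real.exp (-(2 * μ * (Site.tdist z y : ℝ))) := by
      intro x hx
      rw [Finset.mem_filter] at hx
      rw [← Real.exp_add]
      exact Real.exp_le_exp.2 (by nlinarith [hlow z x hx.2])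
    calc ∑ x ∈ Finset.univ.filter (fun x => iterBlockOf (K - n) x = z), Real.exp (-(2 * φ x))
        ≤ ∑ _x ∈ Finset.univ.filter (fun x => iterBlockOf (K - n) x = z), Real.exp (6 * μ) * Real.exp (-(2 * μ * (Site.tdist z y : ℝ))) := Finset.sum_le_sum hle
      _ = ((iterBlock (K - n) z).card : ℝ) * (Real.exp (6 * μ) * Real.exp (-(2 * μ * (Site.tdist z y : ℝ)))) := by
          rw [Finset.sum_const, nsmul_eq_mul]; rfl
      _ = _ := by rw [hcard z]
  have hvol := sum_exp_neg_mul_tdist_coarse_le F (ν := 2 * μ) (by positivity) y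
  calc ∑ z : Site (F.P K) (K - n), ∑ x ∈ Finset.univ.filter (fun x => iterBlockOf (K - n) x = z), Real.exp (-(2 * φ x))
      ≤ ∑ z : Site (F.P K) (K - n), ((F.L : ℝ) ^ (K - n)) ^ 3 * (Real.exp (6 * μ) * Real.exp (-(2 * μ * (Site.tdist z y : ℝ)))) := Finset.sum_le_sum fun z _ => hblock z
    _ = ((F.L : ℝ) ^ (K - n)) ^ 3 * Real.exp (6 * μ) * ∑ z : Site (F.P K) (K - n), Real.exp (-(2 * μ * (Site.tdist z y : ℝ))) := by
        rw [Finset.mul_sum]; exact Finset.sum_congr rfl fun z _ => by ring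
    _ ≤ ((F.L : ℝ) ^ (K - n)) ^ 3 * Real.exp (6 * μ) * (2 * (1 + 1 / (2 * μ))) ^ 3 := by gcongr
    _ = _ := by ring

end Volume

end Summit.QuantumFields.YangMills.Theorems.Prop7LODDivergenceAgmonLetters

end
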